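import Literature.NumberTheory.Weil1964.ArchPlacePhaseHom
import Literature.RepresentationTheory.KonnoKonno2007.RealUnitaryDualPair
import HarnessLib

/-!
# The product of Konno–Konno's real unitary groups over the places as ONE real unitary group:
# `Π_v U(P_v, Q_v) →* U(Σ_v P_v, Σ_v Q_v)` (block diagonal), and its standard embedding slice by slice

Topic `NumberTheory/Weil1964`; namespace `Literature.NumberTheory.Weil1964`.  KERNEL MATHEMATICS ONLY: three explicit
definitions (an index equivalence, a matrix, a group homomorphism) and proved theorems; no `def … : Prop` record, no axiom,
no proof hole.

The archimedean component `U(J)(F ⊗ ℝ) = Π_{v real} U(p_v, q_v)` of the unitary group of ONE hermitian space over a CM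
extension `E/F` acts on weil-1's phase space `ℝ^{ι × o} × ℝ^{ι × o}` (`ι` the coordinates, `o` the real places of `F`)
slice by slice: `piPhaseHom ε (v ↦ UForm.toSp (P v) (Q v))` (`ArchPlacePhaseHom`), i.e. by
`placePhase (v ↦ reindexPhase (ε v) ⇑(toSp (G v)))` — the dictionary `ArchFollandUnitaryPlaces.archPhaseMap_adelicToSymplectic`.
To apply a construction made for ONE real unitary group `U(α, β)` (Konno–Konno's `UForm α β`, e.g. the metaplectic
splitting `U(α, β) →* Mp^𝓢`) to the whole archimedean group at once, this file packages the product as one group: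

* §1 `placeSumIdx ε : ι × o ≃ (Σ v, P v) ⊕ (Σ v, Q v)` — the sign-sorted relabelling of all coordinates at all places;
* §2 `placeDiagMatrix G` — the block-diagonal matrix `diag(G_v)_v` on `(Σ v, P v) ⊕ (Σ v, Q v)`, multiplicative, and
  **`UForm.placeDiag : (Π v, UForm (P v) (Q v)) →* UForm (Σ v, P v) (Σ v, Q v)`** (continuous, `coe_placeDiag`) — the
  orthogonal direct sum `⊕_v (ℂ^{P_v ⊕ Q_v}, diag(1, −1))` IS `(ℂ^{ΣP ⊕ ΣQ}, diag(1, −1))` [Kudla1984, §1];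
* §3 THE SLICE IDENTITY **`reindexSp_toSp_placeDiag`**:
  `reindexSp (placeSumIdx ε) (toSp (placeDiag G)) = piPhaseHom ε (v ↦ toSp (P v) (Q v)) G` — the standard embedding
  `U ↪ Sp` [KonnoKonno2007, §3.1 (3.1)] of the block-diagonal group, read in the coordinates `ι × o`, is the slice-by-slice
  phase map (`twRealify_placeDiagMatrix`, `reindexPhase_twRealify_placeDiagMatrix`); as homomorphisms
  `(reindexSp (placeSumIdx ε)).comp ((toSp _ _).comp placeDiag) = piPhaseHom ε (v ↦ toSp (P v) (Q v))`
  (`reindexSp_comp_toSp_comp_placeDiag`).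

## References

* [KonnoKonno2007] K. Konno, T. Konno, Kyushu J. Math. 61 (2007), §3.1 (3.1) (the embedding `U(p,q) ↪ Sp`).
* [Kudla1984] S. Kudla, *Seesaw dual reductive pairs*, Progr. Math. 46 (1984), §1 (orthogonal direct sums of hermitian
  spaces and the block-diagonal subgroup).
* [Weil1964] A. Weil, Acta Math. 111 (1964), Chap. I n° 12 p. 160 (direct sums of symplectic spaces), Chap. III n° 37
  (products over the places).
-/

set_option autoImplicit false

noncomputable section

open Matrix Complex
open scoped ComplexConjugate

namespace Literature.NumberTheory.Weil1964

open Literature.Analysis.SegalBargmann Literature.RepresentationTheory.HeisenbergGroup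
open Literature.RepresentationTheory.KonnoKonno2007 Literature.RepresentationTheory.KonnoKonno2007.RealDualPair
open Literature.NumberTheory.Automorphic Literature.NumberTheory.Automorphic.UnitaryGroup

variable {ι : Type} [Fintype ι] [DecidableEq ι] {o : Type} [Fintype o] [DecidableEq o]
  {P Q : o → Type} [∀ v, Fintype (P v)] [∀ v, DecidableEq (P v)] [∀ v, Fintype (Q v)] [∀ v, DecidableEq (Q v)]

/-! ## §1 The sign-sorted relabelling of all coordinates at all places -/

/-- **`placeSumIdx ε : ι × o ≃ (Σ v, P v) ⊕ (Σ v, Q v)`**: `(j, v) ↦ inl ⟨v, a⟩` if `ε v j = inl a`, `inr ⟨v, b⟩` if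
`ε v j = inr b`. [cite: Weil1964, Chap. III n° 37] -/
def placeSumIdx (ε : ∀ v, ι ≃ P v ⊕ Q v) : ι × o ≃ (Σ v, P v) ⊕ (Σ v, Q v) :=
  ((Equiv.prodComm ι o).trans (((Equiv.sigmaEquivProd o ι).symm.trans (Equiv.sigmaCongrRight ε)))).trans
    (Equiv.sigmaSumDistrib P Q)

omit [Fintype ι] [DecidableEq ι] [Fintype o] [DecidableEq o] [∀ v, Fintype (P v)] [∀ v, DecidableEq (P v)]
  [∀ v, Fintype (Q v)] [∀ v, DecidableEq (Q v)] in
/-- `placeSumIdx ε (j, v) = sigmaSumDistrib ⟨v, ε v j⟩`. [cite: Weil1964, Chap. III n° 37] -/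
theorem placeSumIdx_apply (ε : ∀ v, ι ≃ P v ⊕ Q v) (j : ι) (v : o) :
    placeSumIdx ε (j, v) = Equiv.sigmaSumDistrib P Q ⟨v, ε v j⟩ := rfl

omit [Fintype ι] [DecidableEq ι] [Fintype o] [DecidableEq o] [∀ v, Fintype (P v)] [∀ v, DecidableEq (P v)]
  [∀ v, Fintype (Q v)] [∀ v, DecidableEq (Q v)] in
/-- `(placeSumIdx ε)⁻¹ (sigmaSumDistrib ⟨v, k⟩) = ((ε v)⁻¹ k, v)`. [cite: Weil1964, Chap. III n° 37] -/
theorem placeSumIdx_symm_apply (ε : ∀ v, ι ≃ P v ⊕ Q v) (v : o) (k : P v ⊕ Q v) :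
    (placeSumIdx ε).symm (Equiv.sigmaSumDistrib P Q ⟨v, k⟩) = ((ε v).symm k, v) := by
  rw [Equiv.symm_apply_eq, placeSumIdx_apply, Equiv.apply_symm_apply]

/-! ## §2 The block-diagonal matrix and the homomorphism `Π_v U(P_v, Q_v) →* U(ΣP, ΣQ)` -/

/-- **`diag(G_v)_v`** on `(Σ v, P v) ⊕ (Σ v, Q v)`: the block-diagonal matrix, relabelled by `sigmaSumDistrib`.
[cite: Kudla1984, §1] -/
def placeDiagMatrix (G : ∀ v, Matrix (P v ⊕ Q v) (P v ⊕ Q v) ℂ) :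
    Matrix ((Σ v, P v) ⊕ (Σ v, Q v)) ((Σ v, P v) ⊕ (Σ v, Q v)) ℂ :=
  Matrix.reindex (Equiv.sigmaSumDistrib P Q) (Equiv.sigmaSumDistrib P Q) (Matrix.blockDiagonal' G)

omit [Fintype ι] [DecidableEq ι] [Fintype o] [∀ v, Fintype (P v)] [∀ v, DecidableEq (P v)]
  [∀ v, Fintype (Q v)] [∀ v, DecidableEq (Q v)] in
/-- entries: `diag(G_v) (⟨v, k⟩, ⟨v, k'⟩) = G_v k k'`. [cite: Weil1964, Chap. III n° 37] -/
theorem placeDiagMatrix_apply_same (G : ∀ v, Matrix (P v ⊕ Q v) (P v ⊕ Q v) ℂ) (v : o) (k k' : P v ⊕ Q v) :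
    placeDiagMatrix G (Equiv.sigmaSumDistrib P Q ⟨v, k⟩) (Equiv.sigmaSumDistrib P Q ⟨v, k'⟩) = G v k k' := by
  rw [placeDiagMatrix, Matrix.reindex_apply, Matrix.submatrix_apply, Equiv.symm_apply_apply, Equiv.symm_apply_apply,
    Matrix.blockDiagonal'_apply_eq]

omit [Fintype ι] [DecidableEq ι] [Fintype o] [∀ v, Fintype (P v)] [∀ v, DecidableEq (P v)]
  [∀ v, Fintype (Q v)] [∀ v, DecidableEq (Q v)] in
/-- entries: `diag(G_v) (⟨v, k⟩, ⟨w, k'⟩) = 0` for `v ≠ w`. [cite: Weil1964, Chap. III n° 37] -/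
theorem placeDiagMatrix_apply_ne (G : ∀ v, Matrix (P v ⊕ Q v) (P v ⊕ Q v) ℂ) {v w : o} (h : v ≠ w) (k : P v ⊕ Q v)
    (k' : P w ⊕ Q w) :
    placeDiagMatrix G (Equiv.sigmaSumDistrib P Q ⟨v, k⟩) (Equiv.sigmaSumDistrib P Q ⟨w, k'⟩) = 0 := by
  rw [placeDiagMatrix, Matrix.reindex_apply, Matrix.submatrix_apply, Equiv.symm_apply_apply, Equiv.symm_apply_apply,
    Matrix.blockDiagonal'_apply_ne G k k' h]

omit [Fintype ι] [DecidableEq ι] [∀ v, Fintype (P v)] [∀ v, DecidableEq (P v)] [∀ v, DecidableEq (Q v)] in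
/-- `diag` is multiplicative. [cite: Weil1964, Chap. III n° 37] -/
theorem placeDiagMatrix_mul [∀ v, Fintype (P v)] (G H : ∀ v, Matrix (P v ⊕ Q v) (P v ⊕ Q v) ℂ) :
    placeDiagMatrix (fun v => G v * H v) = placeDiagMatrix G * placeDiagMatrix H := by
  rw [placeDiagMatrix, placeDiagMatrix, placeDiagMatrix, Matrix.blockDiagonal'_mul, Matrix.reindex_apply,
    Matrix.reindex_apply, Matrix.reindex_apply, Matrix.submatrix_mul_equiv]

omit [Fintype ι] [DecidableEq ι] [Fintype o] [∀ v, Fintype (P v)] [∀ v, Fintype (Q v)] in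
/-- `diag(1) = 1`. [cite: Weil1964, Chap. III n° 37] -/
theorem placeDiagMatrix_one : placeDiagMatrix (fun v => (1 : Matrix (P v ⊕ Q v) (P v ⊕ Q v) ℂ)) = 1 := by
  have h1 : (fun v => (1 : Matrix (P v ⊕ Q v) (P v ⊕ Q v) ℂ)) = 1 := rfl
  rw [placeDiagMatrix, h1, Matrix.blockDiagonal'_one, Matrix.reindex_apply, Matrix.submatrix_one_equiv]

omit [Fintype ι] [DecidableEq ι] [Fintype o] [DecidableEq o] [∀ v, Fintype (P v)] [∀ v, DecidableEq (P v)]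
  [∀ v, Fintype (Q v)] [∀ v, DecidableEq (Q v)] in
/-- `diag` commutes with entrywise conjugation. [cite: Weil1964, Chap. III n° 37] -/
theorem placeDiagMatrix_map_star [DecidableEq o] (G : ∀ v, Matrix (P v ⊕ Q v) (P v ⊕ Q v) ℂ) :
    (placeDiagMatrix G).map (starRingEnd ℂ) = placeDiagMatrix fun v => (G v).map (starRingEnd ℂ) := by
  rw [placeDiagMatrix, placeDiagMatrix, Matrix.reindex_apply, Matrix.reindex_apply,
    ← Matrix.blockDiagonal'_map G (starRingEnd ℂ) (map_zero _), Matrix.submatrix_map]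

omit [Fintype ι] [DecidableEq ι] [Fintype o] [∀ v, Fintype (P v)] [∀ v, DecidableEq (P v)]
  [∀ v, Fintype (Q v)] [∀ v, DecidableEq (Q v)] in
/-- `diag` commutes with transposition. [cite: Weil1964, Chap. III n° 37] -/
theorem placeDiagMatrix_transpose (G : ∀ v, Matrix (P v ⊕ Q v) (P v ⊕ Q v) ℂ) :
    (placeDiagMatrix G)ᵀ = placeDiagMatrix fun v => (G v)ᵀ := by
  rw [placeDiagMatrix, placeDiagMatrix, Matrix.reindex_apply, Matrix.reindex_apply, Matrix.transpose_submatrix,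
    Matrix.blockDiagonal'_transpose]

omit [Fintype ι] [DecidableEq ι] [Fintype o] [∀ v, Fintype (P v)] [∀ v, Fintype (Q v)] in
/-- the sign form of the sum is the block-diagonal of the sign forms: `diag(1_{ΣP}, −1_{ΣQ}) = diag(diag(1_{P_v}, −1_{Q_v}))_v`.
[cite: Kudla1984, §1] -/
theorem placeDiagMatrix_signForm : placeDiagMatrix (fun v => signForm (P v) (Q v)) = signForm (Σ v, P v) (Σ v, Q v) := by
  ext x y
  obtain ⟨⟨v, k⟩, rfl⟩ := (Equiv.sigmaSumDistrib P Q).surjective x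
  obtain ⟨⟨w, k'⟩, rfl⟩ := (Equiv.sigmaSumDistrib P Q).surjective y
  by_cases h : v = w
  · subst h
    rw [placeDiagMatrix_apply_same]
    rcases k with a | b <;> rcases k' with a' | b'
    · show (1 : Matrix (P v) (P v) ℂ) a a' = (1 : Matrix (Σ v, P v) (Σ v, P v) ℂ) ⟨v, a⟩ ⟨v, a'⟩
      simp only [Matrix.one_apply, Sigma.mk.inj_iff, heq_eq_eq, true_and]
    · rfl
    · rfl
    · show (-1 : Matrix (Q v) (Q v) ℂ) b b' = (-1 : Matrix (Σ v, Q v) (Σ v, Q v) ℂ) ⟨v, b⟩ ⟨v, b'⟩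
      simp only [Matrix.neg_apply, Matrix.one_apply, Sigma.mk.inj_iff, heq_eq_eq, true_and]
  · rw [placeDiagMatrix_apply_ne _ h]
    rcases k with a | b <;> rcases k' with a' | b'
    · show (0 : ℂ) = (1 : Matrix (Σ v, P v) (Σ v, P v) ℂ) ⟨v, a⟩ ⟨w, a'⟩
      rw [Matrix.one_apply_ne fun e => h (congrArg Sigma.fst e)]
    · rfl
    · rfl
    · show (0 : ℂ) = (-1 : Matrix (Σ v, Q v) (Σ v, Q v) ℂ) ⟨v, b⟩ ⟨w, b'⟩
      rw [Matrix.neg_apply, Matrix.one_apply_ne fun e => h (congrArg Sigma.fst e), neg_zero]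

/-- `diag(G_v)` as an invertible matrix. [cite: Weil1964, Chap. III n° 37] -/
def placeDiagGL (G : ∀ v, UForm (P v) (Q v)) : GL ((Σ v, P v) ⊕ (Σ v, Q v)) ℂ where
  val := placeDiagMatrix fun v => ((G v : GL (P v ⊕ Q v) ℂ) : Matrix (P v ⊕ Q v) (P v ⊕ Q v) ℂ)
  inv := placeDiagMatrix fun v => (((G v : GL (P v ⊕ Q v) ℂ)⁻¹ : GL (P v ⊕ Q v) ℂ) : Matrix (P v ⊕ Q v) (P v ⊕ Q v) ℂ)
  val_inv := by
    rw [← placeDiagMatrix_mul]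
    simp only [Units.mul_inv, placeDiagMatrix_one]
  inv_val := by
    rw [← placeDiagMatrix_mul]
    simp only [Units.inv_mul, placeDiagMatrix_one]

/-- `diag(G_v) ∈ U(ΣP, ΣQ)`. [cite: Kudla1984, §1] -/
theorem placeDiagGL_mem (G : ∀ v, UForm (P v) (Q v)) :
    placeDiagGL G ∈ unitaryGroupOfForm (starRingEnd ℂ) (signForm (Σ v, P v) (Σ v, Q v)) := by
  rw [mem_unitaryGroupOfForm_iff]
  show ((placeDiagMatrix fun v => ((G v : GL (P v ⊕ Q v) ℂ) : Matrix (P v ⊕ Q v) (P v ⊕ Q v) ℂ)).map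
      (starRingEnd ℂ))ᵀ * signForm (Σ v, P v) (Σ v, Q v) *
      placeDiagMatrix (fun v => ((G v : GL (P v ⊕ Q v) ℂ) : Matrix (P v ⊕ Q v) (P v ⊕ Q v) ℂ)) = _
  rw [placeDiagMatrix_map_star, placeDiagMatrix_transpose, ← placeDiagMatrix_signForm, ← placeDiagMatrix_mul,
    ← placeDiagMatrix_mul]
  congr 1
  funext v
  exact (mem_unitaryGroupOfForm_iff.1 (G v).2)

/-- **`UForm.placeDiag : (Π v, U(P_v, Q_v)) →* U(Σ_v P_v, Σ_v Q_v)`**, `G ↦ diag(G_v)_v` — the product of the real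
unitary groups at the places as the block-diagonal subgroup of the unitary group of the orthogonal direct sum.
[cite: Kudla1984, §1; Weil1964, Chap. III n° 37] -/
def UForm.placeDiag : (∀ v, UForm (P v) (Q v)) →* UForm (Σ v, P v) (Σ v, Q v) where
  toFun G := ⟨placeDiagGL G, placeDiagGL_mem G⟩
  map_one' := Subtype.ext (Units.ext (by
    show placeDiagMatrix (fun v => (((1 : ∀ v, UForm (P v) (Q v)) v : GL (P v ⊕ Q v) ℂ) :
      Matrix (P v ⊕ Q v) (P v ⊕ Q v) ℂ)) = 1
    simp only [Pi.one_apply, OneMemClass.coe_one, Units.val_one, placeDiagMatrix_one]))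
  map_mul' G H := Subtype.ext (Units.ext (by
    show placeDiagMatrix (fun v => (((G * H) v : GL (P v ⊕ Q v) ℂ) : Matrix (P v ⊕ Q v) (P v ⊕ Q v) ℂ)) =
      placeDiagMatrix (fun v => ((G v : GL (P v ⊕ Q v) ℂ) : Matrix (P v ⊕ Q v) (P v ⊕ Q v) ℂ)) *
        placeDiagMatrix (fun v => ((H v : GL (P v ⊕ Q v) ℂ) : Matrix (P v ⊕ Q v) (P v ⊕ Q v) ℂ))
    rw [← placeDiagMatrix_mul]
    rfl))

/-- matrix of `placeDiag G`: `diag(G_v)_v`. [cite: Weil1964, Chap. III n° 37] -/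
@[simp] theorem UForm.coe_placeDiag (G : ∀ v, UForm (P v) (Q v)) :
    (((UForm.placeDiag G : UForm (Σ v, P v) (Σ v, Q v)) : GL ((Σ v, P v) ⊕ (Σ v, Q v)) ℂ) :
        Matrix ((Σ v, P v) ⊕ (Σ v, Q v)) ((Σ v, P v) ⊕ (Σ v, Q v)) ℂ) =
      placeDiagMatrix fun v => ((G v : GL (P v ⊕ Q v) ℂ) : Matrix (P v ⊕ Q v) (P v ⊕ Q v) ℂ) := rfl

/-- `placeDiag` is continuous. [cite: Weil1964, Chap. III n° 37] -/
theorem UForm.continuous_placeDiag : Continuous (UForm.placeDiag (P := P) (Q := Q)) := by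
  have h1 : Continuous fun G : ∀ v, UForm (P v) (Q v) => fun v =>
      ((G v : GL (P v ⊕ Q v) ℂ) : Matrix (P v ⊕ Q v) (P v ⊕ Q v) ℂ) :=
    continuous_pi fun v => Units.continuous_val.comp (continuous_subtype_val.comp (continuous_apply v))
  have h2 : Continuous fun G : ∀ v, UForm (P v) (Q v) => fun v =>
      (((G v : GL (P v ⊕ Q v) ℂ)⁻¹ : GL (P v ⊕ Q v) ℂ) : Matrix (P v ⊕ Q v) (P v ⊕ Q v) ℂ) :=
    continuous_pi fun v => Units.continuous_coe_inv.comp (continuous_subtype_val.comp (continuous_apply v))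
  refine Continuous.subtype_mk (Units.continuous_iff.2 ⟨?_, ?_⟩) _
  · show Continuous fun G : ∀ v, UForm (P v) (Q v) =>
      placeDiagMatrix fun v => ((G v : GL (P v ⊕ Q v) ℂ) : Matrix (P v ⊕ Q v) (P v ⊕ Q v) ℂ)
    exact h1.matrix_blockDiagonal'.matrix_submatrix _ _
  · show Continuous fun G : ∀ v, UForm (P v) (Q v) =>
      placeDiagMatrix fun v => (((G v : GL (P v ⊕ Q v) ℂ)⁻¹ : GL (P v ⊕ Q v) ℂ) : Matrix (P v ⊕ Q v) (P v ⊕ Q v) ℂ)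
    exact h2.matrix_blockDiagonal'.matrix_submatrix _ _

/-! ## §3 The standard embedding of the block-diagonal group is the slice-by-slice phase map -/

omit [Fintype ι] [DecidableEq ι] [Fintype o] [DecidableEq o] [∀ v, Fintype (P v)] [∀ v, DecidableEq (P v)]
  [∀ v, Fintype (Q v)] [∀ v, DecidableEq (Q v)] in
/-- the twist `tw` on `(ΣP) ⊕ (ΣQ)` restricted to the slice `v` is the twist on `P_v ⊕ Q_v`. [cite: Weil1964, Chap. III n° 37] -/
theorem tw_sigmaSumDistrib (X : (Σ v, P v) ⊕ (Σ v, Q v) → ℂ) (v : o) (k : P v ⊕ Q v) :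
    tw X (Equiv.sigmaSumDistrib P Q ⟨v, k⟩) = tw (fun k' => X (Equiv.sigmaSumDistrib P Q ⟨v, k'⟩)) k := by
  rcases k with a | b <;> rfl

omit [Fintype ι] [DecidableEq ι] [∀ v, DecidableEq (P v)] [∀ v, DecidableEq (Q v)] in
/-- `diag(G_v) X` on the slice `v` is `G_v X_v`. [cite: Weil1964, Chap. III n° 37] -/
theorem placeDiagMatrix_mulVec (G : ∀ v, Matrix (P v ⊕ Q v) (P v ⊕ Q v) ℂ) (X : (Σ v, P v) ⊕ (Σ v, Q v) → ℂ) (v : o)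
    (k : P v ⊕ Q v) :
    (placeDiagMatrix G *ᵥ X) (Equiv.sigmaSumDistrib P Q ⟨v, k⟩) =
      (G v *ᵥ fun k' => X (Equiv.sigmaSumDistrib P Q ⟨v, k'⟩)) k := by
  rw [Matrix.mulVec, Matrix.mulVec, dotProduct, dotProduct,
    ← (Equiv.sigmaSumDistrib P Q).sum_comp, Fintype.sum_sigma, Finset.sum_eq_single v]
  · refine Finset.sum_congr rfl fun k' _ => ?_
    rw [placeDiagMatrix_apply_same]
  · intro w _ hw
    exact Finset.sum_eq_zero fun k' _ => by rw [placeDiagMatrix_apply_ne G (Ne.symm hw), zero_mul]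
  · exact fun h => absurd (Finset.mem_univ v) h

omit [Fintype ι] [DecidableEq ι] [∀ v, DecidableEq (P v)] [∀ v, DecidableEq (Q v)] in
/-- `twMulVec` of `diag(G_v)` on the slice `v` is `twMulVec (G v)` of the slice. [cite: Weil1964, Chap. III n° 37] -/
theorem twMulVec_placeDiagMatrix (G : ∀ v, Matrix (P v ⊕ Q v) (P v ⊕ Q v) ℂ) (X : (Σ v, P v) ⊕ (Σ v, Q v) → ℂ)
    (v : o) (k : P v ⊕ Q v) :
    twMulVec (placeDiagMatrix G) X (Equiv.sigmaSumDistrib P Q ⟨v, k⟩) =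
      twMulVec (G v) (fun k' => X (Equiv.sigmaSumDistrib P Q ⟨v, k'⟩)) k := by
  rw [twMulVec, twMulVec, tw_sigmaSumDistrib]
  have h : (fun k' => (placeDiagMatrix G *ᵥ tw X) (Equiv.sigmaSumDistrib P Q ⟨v, k'⟩)) =
      G v *ᵥ tw fun k' => X (Equiv.sigmaSumDistrib P Q ⟨v, k'⟩) := by
    funext k'
    rw [placeDiagMatrix_mulVec]
    congr 1
    funext k''
    exact tw_sigmaSumDistrib X v k''
  rw [h]

omit [Fintype ι] [DecidableEq ι] [∀ v, DecidableEq (P v)] [∀ v, DecidableEq (Q v)] in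
/-- **THE SLICE IDENTITY (phase maps).** In the coordinates `ι × o`, the twisted realification of `diag(G_v)` is the
slice-by-slice phase map of the twisted realifications. [cite: KonnoKonno2007, §3.1 (3.1); Weil1964, Chap. I n° 12] -/
theorem reindexPhase_twRealify_placeDiagMatrix (ε : ∀ v, ι ≃ P v ⊕ Q v)
    (G : ∀ v, Matrix (P v ⊕ Q v) (P v ⊕ Q v) ℂ) :
    reindexPhase (placeSumIdx ε) (twRealify (placeDiagMatrix G)) =
      placePhase fun v => reindexPhase (ε v) (twRealify (G v)) := by
  funext pq
  have key : ∀ j v, twMulVec (placeDiagMatrix G) (phasePt (pq.1 ∘ (placeSumIdx ε).symm) (pq.2 ∘ (placeSumIdx ε).symm))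
      (placeSumIdx ε (j, v)) =
      twMulVec (G v) (phasePt ((fun j => pq.1 (j, v)) ∘ (ε v).symm) ((fun j => pq.2 (j, v)) ∘ (ε v).symm)) (ε v j) := by
    intro j v
    rw [placeSumIdx_apply, twMulVec_placeDiagMatrix]
    congr 2
    funext k'
    simp only [phasePt, Function.comp_apply, placeSumIdx_symm_apply]
  refine Prod.ext (funext fun k => ?_) (funext fun k => ?_)
  · obtain ⟨j, v⟩ := k
    show (twMulVec (placeDiagMatrix G) _ (placeSumIdx ε (j, v))).re = (twMulVec (G v) _ (ε v j)).re
    rw [key]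
  · obtain ⟨j, v⟩ := k
    show (twMulVec (placeDiagMatrix G) _ (placeSumIdx ε (j, v))).im = (twMulVec (G v) _ (ε v j)).im
    rw [key]

omit [DecidableEq ι] in
/-- **THE SLICE IDENTITY (symplectic group).** `reindexSp (placeSumIdx ε) (toSp (placeDiag G)) = piPhaseHom ε toSp G`.
[cite: KonnoKonno2007, §3.1 (3.1); Weil1964, Chap. I n° 12, Chap. III n° 37] -/
theorem reindexSp_toSp_placeDiag (ε : ∀ v, ι ≃ P v ⊕ Q v) (G : ∀ v, UForm (P v) (Q v)) :
    reindexSp (placeSumIdx ε) (UForm.toSp (Σ v, P v) (Σ v, Q v) (UForm.placeDiag G)) =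
      piPhaseHom ε (fun v => UForm.toSp (P v) (Q v)) G := by
  refine Subtype.ext (LinearEquiv.ext fun pq => ?_)
  have h := congrFun (reindexPhase_twRealify_placeDiagMatrix ε
    (fun v => ((G v : GL (P v ⊕ Q v) ℂ) : Matrix (P v ⊕ Q v) (P v ⊕ Q v) ℂ))) pq
  rw [← UForm.coe_placeDiag, ← UForm.coe_toSp] at h
  simp only [← UForm.coe_toSp] at h
  rw [← coe_reindexSp, ← coe_piPhaseHom] at h
  exact h

omit [DecidableEq ι] in
/-- as homomorphisms: `(reindexSp (placeSumIdx ε)) ∘ toSp ∘ placeDiag = piPhaseHom ε toSp`. [cite: Weil1964, Chap. III n° 37] -/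
theorem reindexSp_comp_toSp_comp_placeDiag (ε : ∀ v, ι ≃ P v ⊕ Q v) :
    (reindexSp (placeSumIdx ε)).comp ((UForm.toSp (Σ v, P v) (Σ v, Q v)).comp UForm.placeDiag) =
      piPhaseHom ε (fun v => UForm.toSp (P v) (Q v)) :=
  MonoidHom.ext fun G => reindexSp_toSp_placeDiag ε G

end Literature.NumberTheory.Weil1964

end
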